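import Summits.BirchSwinnertonDyer.BirchSwinnertonDyer.Theorems.ManinLocalTwoThreeKummerWitnessExtensionB
import Summits.BirchSwinnertonDyer.BirchSwinnertonDyer.Theorems.ManinLocalTwoThreeKummerWitnessInvarianceB
import Summits.BirchSwinnertonDyer.BirchSwinnertonDyer.Theorems.ManinLocalTwoThreeIntegralQSeriesNearCuspB
import Summits.BirchSwinnertonDyer.Rank1Residual.ManinAdditive.UDCKummerWitnessLineHolds
import HarnessLib

/-!
# The B-LINE of the C3 witness law BY NAME: (WL♭), (WL) and (AN♮) from the TWO open pieces (DICT) and (RATB)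
(route `ManinLocalTwoThree`, crux C3 `ManinPrimeToThreeAtNine` stmt-BirchSwinnertonDyer-22968; cell bsd-f2-manin, prover seat p2 gen 18;
`--supports stmt-BirchSwinnertonDyer-22968`)

-an g38's B-line (`UDCKummerWitnessLineB`, p730675; compositions with (QXP) discharged in `UDCKummerWitnessLineHolds`, p730961) reads
(INT) → (DICT) → (RATB) → (HOLB) → (QEXNB) → (INVB) → (WL♭) → (WL) / (AN♮).  Four of the six pieces are THEOREMS in the tree, by name:
(INT) `IntegralQSeries.minimalKummerCubeRootIntegral_holds` (C3 LEAD, p730250, over p3's p728452), (HOLB) `WitnessInvariance.kummerMinimalWitnessExtensionB_holds`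
(p2, p731758), (QEXNB) `IntegralQSeries.integralQSeriesNearCuspB_holds` (p1/p2, p732744/p732758), (INVB) `WitnessInvariance.kummerMinimalWitnessInvarianceB_holds`
(p2, p731884).  This file feeds them in, leaving the B-line as implications from EXACTLY the two open pieces:

* `kummerCubeRootModularFormWitnessNearCusp_of_DICT_of_RATB : KummerMinimalDictionary → KummerMinimalParamPresentation → (WL♭)`,
* `kummerCubeRootModularFormWitness_of_DICT_of_RATB : … → (WL)` (v23 stub shape),
* `kummerCubeRootCongruenceOfBoundedOfUDC_of_DICT_of_RATB : … → (AN♮)` (the UDC line's analytic node, consumed by the C3 LEAD's skeleton through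
  `UDWOfCDT.maninPrimeToThreeAtNine_of_katoFactKP_of_CDT_udcNine_of_coprimeIsolated`).

So a C3 skeleton on the B-line carries the stubs {F₃♮, CDT, (DICT), (RATB), RES₃♭} and nothing else of the witness ((DICT) is with the C3 LEAD p1 g16 —
`MinimalDictionary.kummerMinimalDictionary_holds` announced 16:35Z —, (RATB) with p3 g16).

HONEST FRAMING.  Pure composition of landed theorems; (WL♭), (WL), (AN♮), C3, Manin's conjecture and BSD are NOT proved here — the results are
CONDITIONAL on (DICT) and (RATB).  No definitions, no sorry, no new axioms. [folklore]
-/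

set_option autoImplicit false
-- lint-debt: the directory name repeats the summit name (sibling precedent `ManinLocalTwoThreeUDCGlue.lean`)
set_option linter.dupNamespace false

noncomputable section

namespace Summit.BirchSwinnertonDyer.BirchSwinnertonDyer.Theorems.ManinLocalTwoThree.WitnessBLine

open Summit.BirchSwinnertonDyer.Rank1Residual.ManinAdditive.UDCKummerLine
open Summit.BirchSwinnertonDyer.Rank1Residual.ManinAdditive.UDCKummerWitnessLine
open Summit.BirchSwinnertonDyer.BirchSwinnertonDyer.Theorems.ManinLocalTwoThree.IntegralQSeries
  (minimalKummerCubeRootIntegral_holds integralQSeriesNearCuspB_holds)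
open Summit.BirchSwinnertonDyer.BirchSwinnertonDyer.Theorems.ManinLocalTwoThree.WitnessInvariance
  (kummerMinimalWitnessExtensionB_holds kummerMinimalWitnessInvarianceB_holds)

/-- **B-line, (DICT) → (RATB) → (WL♭)**: an's `kummerCubeRootModularFormWitnessNearCusp_of_piecesB` with (INT), (HOLB), (QEXNB), (INVB) fed BY NAME.
CONDITIONAL on the two hypotheses. [folklore] -/
theorem kummerCubeRootModularFormWitnessNearCusp_of_DICT_of_RATB
    (hDICT : KummerMinimalDictionary) (hRATB : KummerMinimalParamPresentation) :
    KummerCubeRootModularFormWitnessNearCusp :=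
  kummerCubeRootModularFormWitnessNearCusp_of_piecesB minimalKummerCubeRootIntegral_holds hDICT hRATB
    kummerMinimalWitnessExtensionB_holds integralQSeriesNearCuspB_holds kummerMinimalWitnessInvarianceB_holds

/-- **B-line, (DICT) → (RATB) → (WL)** (the C3 LEAD's v23 stub shape `KummerCubeRootModularFormWitness`; (QXP) discharged by
`qExpansionExtensionPrinciple_holds`).  CONDITIONAL on the two hypotheses. [folklore] -/
theorem kummerCubeRootModularFormWitness_of_DICT_of_RATB
    (hDICT : KummerMinimalDictionary) (hRATB : KummerMinimalParamPresentation) :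
    KummerCubeRootModularFormWitness :=
  kummerCubeRootModularFormWitness_of_piecesB' minimalKummerCubeRootIntegral_holds hDICT hRATB
    kummerMinimalWitnessExtensionB_holds integralQSeriesNearCuspB_holds kummerMinimalWitnessInvarianceB_holds

/-- **B-line, (DICT) → (RATB) → (AN♮)** `KummerCubeRootCongruenceOfBoundedOfUDC` — the analytic node of the UDC line consumed by the C3 skeleton.
CONDITIONAL on the two hypotheses; C3 is NOT proved by this. [folklore] -/
theorem kummerCubeRootCongruenceOfBoundedOfUDC_of_DICT_of_RATB
    (hDICT : KummerMinimalDictionary) (hRATB : KummerMinimalParamPresentation) :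
    KummerCubeRootCongruenceOfBoundedOfUDC :=
  kummerCubeRootCongruenceOfBoundedOfUDC_of_piecesB minimalKummerCubeRootIntegral_holds hDICT hRATB
    kummerMinimalWitnessExtensionB_holds integralQSeriesNearCuspB_holds kummerMinimalWitnessInvarianceB_holds

end Summit.BirchSwinnertonDyer.BirchSwinnertonDyer.Theorems.ManinLocalTwoThree.WitnessBLine

end
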